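import Summits.ResolutionOfSingularities.ResolutionOfSingularities.Theorems.FrobeniusClosingPatchingRelPerfectDepthLegalTraceN
import Summits.ResolutionOfSingularities.ResolutionOfSingularities.Theorems.FrobeniusClosingPatchingRelPerfectDepthLegalMove
import Summits.ResolutionOfSingularities.ResolutionOfSingularities.Theorems.FrobeniusClosingPatchingRelPerfectDepthLegalOrderLaw
import Literature.AlgebraicGeometry.Resolution.BlowupSequences
import Literature.AlgebraicGeometry.Resolution.PointBlowupHsFunMono
import HarnessLib

/-!
# Crux `PatchingRelPerfect` (stmt-ResolutionOfSingularities-16161), chain W5.2 — T6-E1b residual `LegalScopedDivisorReduction₃`,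
# PHASE 2 closer (2b), spec D2 engine: ONE CURVE MOVE on an integral host component, fully packaged

[OURS · L1 W5.2 · res-L1-w52-lead-1 g5, hand #3b; spec `L/res-L1-w52-lead-1/PHASE2-STEPB-SPEC.md` D2] Replaces the role of NO printed item;
NOT a statement of the manuscript under review; fact-free.

Assembly of bricks B1/D1 (`HostStateN.step`, `HostState.trace_law`, `isBlowup_host`), D3 (`…DepthLegalOrderLaw`) and the glue
(`…DepthLegalMove`): given a state `HostStateN H N D L` whose active host component `X = V(D)` is INTEGRAL, a codimension-one point `ζ` of
`X` lying on the trace `T = M|_X` of the boundary monomial, such that the curve `Z = cl{ι ζ} ⊂ E` is a regular subscheme having normal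
crossings with the boundary, the blowing up `τ : E′ = Bl_Z E → E` is one legal pure-weight-two move and:

* `curve_move` — there is `π_X : X′ = V(τᶜ(D,1)) → X` over `τ`, an ISOMORPHISM (the blowing up of the Cartier prime divisor `𝓟_ζ`); the new
  state is `HostStateN (τᶜ(H,2)) (N𝒪) (τᶜ(D,1)) L′`; `X′` is integral; the new trace `T′ = M′|_{X′}` is non-zero and
  `T𝒪_{X′} = 𝓟_ζ𝒪_{X′} · T′`; its order over `ζ` DROPS BY ONE and is UNCHANGED at every other codimension-one point.

AI-written; AI review is weaker than expert review.

## References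
* J. Kollár, *Lectures on Resolution of Singularities* (2007), 3.30.2. [Kollar2007]
* E. Bierstone, D. Grigoriev, P. Milman, J. Włodarczyk, arXiv:1206.3090, §4 Remark (3), Lemma 3.9.4. [BierstoneGrigorievMilmanWlodarczyk2011]
-/

-- `Summit.<Summit>.<Sub>.Theorems` with `Sub = Summit` (single-conjunct summit, D-0017)
set_option linter.dupNamespace false

noncomputable section

open CategoryTheory CategoryTheory.Limits AlgebraicGeometry TopologicalSpace IsLocalRing
open Literature.AlgebraicGeometry.Resolution Scheme.IdealSheafData

namespace Summit.ResolutionOfSingularities.ResolutionOfSingularities.Theorems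

universe u

namespace DepthLegal

open WeightTwoB DepthTargets

namespace HostStateN

variable {E : Scheme.{u}} [IsLocallyNoetherian E] {H N D : E.IdealSheafData} {L : List (E.IdealSheafData × ℕ)}
  (S : HostStateN H N D L)

include S in
/-- [OURS · L1 W5.2] **ONE CURVE MOVE on an integral host component, packaged** (see the module docstring).
[cite: Kollar2007, 3.30.2] [cite: BierstoneGrigorievMilmanWlodarczyk2011, §4 Remark (3)] -/
theorem curve_move [IsIntegral D.subscheme] (ζ : D.subscheme) (hζ : Order.coheight ζ = 1)
    (hζT : ζ ∈ ((monomialIdeal L).comap D.subschemeι).support) (hT : (monomialIdeal L).comap D.subschemeι ≠ ⊥)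
    (hZ : Scheme.IsRegular (vanishingIdeal ⟨closure {D.subschemeι ζ}, isClosed_closure⟩).subscheme)
    (hnc : HasSNCWith (boundaryOf L) (vanishingIdeal ⟨closure {D.subschemeι ζ}, isClosed_closure⟩)) :
    let C : E.IdealSheafData := vanishingIdeal ⟨closure {D.subschemeι ζ}, isClosed_closure⟩
    let τ := blowup.π C
    let w := weightAt L (D.subschemeι ζ)
    let D' := controlledTransform τ C D 1
    let L' := stepExp L τ C (w - 1)
    let T := (monomialIdeal L).comap D.subschemeι
    let T' := (monomialIdeal L').comap D'.subschemeι
    ∃ πX : D'.subscheme ⟶ D.subscheme,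
      πX ≫ D.subschemeι = D'.subschemeι ≫ τ ∧ IsBlowup πX (primeDivisorIdeal ζ) ∧ IsIso πX ∧
      @HostStateN (blowup C) (blowup.isBlowup C).isLocallyNoetherian (controlledTransform τ C H 2) (N.comap τ) D' L' ∧
      IsIntegral D'.subscheme ∧ T' ≠ ⊥ ∧
      T' = (primeDivisorIdeal ζ).comap πX ^ (w - 1) * controlledTransform πX (primeDivisorIdeal ζ) T w ∧
      T.comap πX = (primeDivisorIdeal ζ).comap πX * T' ∧
      (∀ ζ' : D'.subscheme, πX ζ' = ζ → idealOrder T' ζ' + 1 = idealOrder T ζ) ∧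
      (∀ y' : D'.subscheme, Order.coheight (πX y') = 1 → ζ ≠ πX y' → idealOrder T' y' = idealOrder T (πX y')) := by
  intro C τ w D' L' T T'
  have hτ : IsBlowup τ C := blowup.isBlowup C
  haveI : IsLocallyNoetherian (blowup C) := hτ.isLocallyNoetherian
  have hη : IsGenericPoint (D.subschemeι ζ) ((⟨closure {D.subschemeι ζ}, isClosed_closure⟩ : Closeds E) : Set E) :=
    isGenericPoint_closure
  have hZX : ((⟨closure {D.subschemeι ζ}, isClosed_closure⟩ : Closeds E) : Set E) ⊆ D.support :=
    closure_minimal (Set.singleton_subset_iff.mpr (subschemeι_apply_mem_support D ζ)) D.support.isClosed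
  have hζM : D.subschemeι ζ ∈ (monomialIdeal L).support := (mem_support_comap_iff D.subschemeι (monomialIdeal L) ζ).mp hζT
  have hZM : ((⟨closure {D.subschemeι ζ}, isClosed_closure⟩ : Closeds E) : Set E) ⊆ (monomialIdeal L).support :=
    closure_minimal (Set.singleton_subset_iff.mpr hζM) (monomialIdeal L).support.isClosed
  -- the move and the host morphism
  have S' := S.step hη hZ hZX hZM hnc hτ
  obtain ⟨πX, hπX⟩ := exists_hom_subscheme_controlledTransform τ C D
  have hbl : IsBlowup πX (C.comap D.subschemeι) := S.toHostState.isBlowup_host hZ hZX hτ πX hπX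
  have hPC : C.comap D.subschemeι = primeDivisorIdeal ζ := comap_subschemeι_vanishingIdeal_closure ζ
  rw [hPC] at hbl
  -- the trace law in `𝓟_ζ` form
  have hlaw := S.toHostState.trace_law hη hZ hZX hnc hτ πX hπX
  rw [hPC] at hlaw
  -- integral regular host, orders
  have hX : Scheme.IsRegular D.subscheme := by
    -- (= `HostState.isRegular_host` of …DepthLegalStepA, inlined to keep this file's imports light)
    intro s
    rw [isRegularLocalRing_stalk_subscheme_iff]
    haveI : IsRegularLocalRing (E.presheaf.stalk (D.subschemeι.base s)) := S.regE _
    obtain ⟨v, hv, hv2⟩ := S.hostHyp _ (subschemeι_apply_mem_support D s)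
    have hvm : v ∈ maximalIdeal (E.presheaf.stalk (D.subschemeι.base s)) :=
      (Ideal.span_singleton_le_iff_mem _).mp (hv ▸ (mem_support_iff_stalkIdeal_le D _).mp (subschemeι_apply_mem_support D s))
    rw [hv]
    exact (IsRegularLocalRing.quotient_span_singleton hvm hv2).1
  haveI : IsLocallyNoetherian D.subscheme := LocallyOfFiniteType.isLocallyNoetherian D.subschemeι
  have hw : 1 ≤ w := S.toHostState.one_le_weightAt hη hZM
  have hwT : (w : ℕ∞) ≤ idealOrder T ζ := S.toHostState.weightAt_le_idealOrder_trace ζ hZ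
  have hTne : T ≠ ⊥ := hT
  haveI hiso0 : IsIso πX := hbl.isIso (isEffectiveCartier_primeDivisorIdeal_of_isRegular hX hζ)
  haveI : Nonempty D'.subscheme := ⟨(inv πX).base ζ⟩
  obtain ⟨hfac, hiso, -, hint, hT'ne⟩ := trace_facts hX hζ hbl hTne hw hwT
  refine ⟨πX, hπX, hbl, hiso, S', hint, ?_, hlaw, ?_, ?_, ?_⟩
  · rw [show T' = _ from hlaw]; exact hT'ne
  · rw [show T' = _ from hlaw]; exact hfac
  · intro ζ' hζ'
    rw [show T' = _ from hlaw]
    exact idealOrder_trace_self hX hζ hbl hTne hw hwT hζ'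
  · intro y' hy hne
    rw [show T' = _ from hlaw]
    exact idealOrder_trace_of_ne hX hζ hbl hTne hw hwT hy hne

end HostStateN

end DepthLegal

end Summit.ResolutionOfSingularities.ResolutionOfSingularities.Theorems

end
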